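import Literature.Barriers.AnomalousDissipation.IntermittentDissipationProofs
import Literature.Analysis.FluidPDE.DuchonRobertPressure
import Literature.Analysis.FunctionSpaces.TorusRieszTransformProofs
import HarnessLib

/-!
# De Rosa–Isett's vanishing-viscosity intermittency theorem (Thm. 2.13): assembly from its two remaining named inputs

`Literature.Barriers.AnomalousDissipation.IntermittentDissipation` vendors
`DeRosaIsett2024_thm213` (De Rosa–Isett, ARMA 248 (2024), Thm. 2.13 of arXiv:2212.08176) as a
named fact, and `IntermittentDissipationProofs` proves it from three inputs
(`DeRosaIsett2024_thm213_of_steps`): De Rosa–Isett's Thm. 2.7 (`DeRosaIsett2024_thm27`), the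
Aubin–Lions–Simon step of §6.1 (`DeRosaIsett2024_s61_compactness`) — both named in
`IntermittentDissipationSteps` — and the Calderón–Zygmund pressure fact
`Torus.exists_pressure_of_tendsto_L3` of `Literature.Analysis.FluidPDE.DuchonRobertInviscidLimit`
(Duchon–Robert 2000, proof of Prop. 1; Robinson–Rodrigo–Sadowski 2016, Lemma 5.1 and Prop. 5.3).

The third input is now a theorem of the tree in every dimension: `Torus.exists_pressure_of_tendsto_L3_of`
(`Literature.Analysis.FluidPDE.DuchonRobertPressure`) reduces it to the Calderón–Zygmund Hessian
bound `Torus.eLpNorm_hessian_le_laplacian d` on `T^d` (Robinson–Rodrigo–Sadowski 2016, App. B,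
Thm. B.7), which `Torus.eLpNorm_hessian_le_laplacian_holds`
(`Literature.Analysis.FunctionSpaces.TorusRieszTransformProofs`) proves for every finite index type
from the whole-space bound of Stein 1970, Ch. III §1.3, Prop. 3
(`Literature.Analysis.FluidPDE.stein1970_hessian_Lp_bound_holds`). This file records the
resulting two-hypothesis assembly

* `DeRosaIsett2024_thm213_of_thm27_of_compactness :
    DeRosaIsett2024_thm27 → DeRosaIsett2024_s61_compactness → DeRosaIsett2024_thm213`,

so that the discharge `DeRosaIsett2024_thm213_holds` is this theorem applied to
`DeRosaIsett2024_thm27_holds` and `DeRosaIsett2024_s61_compactness_holds` once those two named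
facts are proved (both are in flight in sibling files: `IntermittentDissipationThm27Steps` /
`IntermittentDissipationThm27Limit` decompose Thm. 2.7 along §5.1, and
`Literature.Analysis.FluidPDE.ClassicalNSFourierModes` starts the compactness step).

## References

* L. De Rosa, P. Isett, *Intermittency and lower dimensional dissipation in incompressible
  fluids*, Arch. Ration. Mech. Anal. 248 (2024), Paper No. 11; arXiv:2212.08176: Thm. 2.13 and
  its proof, §6.1; Thm. 2.7. [DeRosaIsett2024]
* J. Duchon, R. Robert, Nonlinearity 13 (2000) 249–255, proof of Prop. 1, pp. 250–251 (the
  `L^{3/2}` pressure). [DuchonRobert2000]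
* J. C. Robinson, J. L. Rodrigo, W. Sadowski, *The Three-Dimensional Navier–Stokes Equations*,
  CUP 2016: Lemma 5.1, Prop. 5.3; App. B, Thm. B.7. [RobinsonRodrigoSadowskiCUP2016]
* E. M. Stein, *Singular integrals and differentiability properties of functions* (1970),
  Ch. III §1.3, Prop. 3. [Stein1971]
-/

open MeasureTheory Set Filter Topology Metric Function
open scoped ENNReal NNReal

noncomputable section

namespace Literature.Barriers.AnomalousDissipation

/-- **The Calderón–Zygmund pressure input of the assembly, in every dimension** (Duchon–Robert
2000, proof of Prop. 1; Robinson–Rodrigo–Sadowski 2016, Lemma 5.1 and Prop. 5.3): the named fact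
`Torus.exists_pressure_of_tendsto_L3` holds for every finite index type `d`, every `T` and every
limit field `v`, by `Torus.exists_pressure_of_tendsto_L3_of` fed with the proved Calderón–Zygmund
Hessian bound `Torus.eLpNorm_hessian_le_laplacian_holds` on `T^d`. Stated in the exact shape of the
hypothesis `hA1` of `DeRosaIsett2024_thm213_of_steps`. [cite: DuchonRobert2000, proof of Prop. 1 (pp. 250–251)] -/
theorem DeRosaIsett2024.exists_pressure_of_tendsto_L3_all
    {d : Type} [Fintype d] {T : ℝ} {v : ℝ → UnitAddTorus d → EuclideanSpace ℝ d} :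
    Literature.Analysis.FluidPDE.Torus.exists_pressure_of_tendsto_L3 (d := d) (T := T) (u := v) :=
  Literature.Analysis.FluidPDE.Torus.exists_pressure_of_tendsto_L3_of
    Literature.Analysis.FunctionSpaces.Torus.eLpNorm_hessian_le_laplacian_holds

/-- **De Rosa–Isett's Thm. 2.13 from its two remaining named inputs** — Thm. 2.7
(`DeRosaIsett2024_thm27`) and the Aubin–Lions–Simon step of §6.1
(`DeRosaIsett2024_s61_compactness`): the three-hypothesis assembly
`DeRosaIsett2024_thm213_of_steps` of `IntermittentDissipationProofs` with its Calderón–Zygmund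
pressure hypothesis discharged by `DeRosaIsett2024.exists_pressure_of_tendsto_L3_all`. Once the two
inputs are proved, `DeRosaIsett2024_thm213_holds` is
`DeRosaIsett2024_thm213_of_thm27_of_compactness DeRosaIsett2024_thm27_holds DeRosaIsett2024_s61_compactness_holds`.
[cite: DeRosaIsett2024, Thm. 2.13 and §6.1] -/
theorem DeRosaIsett2024_thm213_of_thm27_of_compactness (h27 : DeRosaIsett2024_thm27)
    (hc : DeRosaIsett2024_s61_compactness) : DeRosaIsett2024_thm213 :=
  DeRosaIsett2024_thm213_of_steps h27 hc DeRosaIsett2024.exists_pressure_of_tendsto_L3_all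

end Literature.Barriers.AnomalousDissipation

end
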